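import Summits.QuantumFields.YangMills.Theorems.BalabanUVNodesN09NestingFromSupport
import Summits.QuantumFields.YangMills.Theorems.BalabanUVNodesN09HeredModFineOfThm1
import Summits.QuantumFields.YangMills.Theorems.BalabanUVNodesN21AveragedDatumRegularity

/-!
# BalabanUVNodes ∕ N09 at the STAGE-13 v1.7 `SepCoPH` record — the localised door WITH THE SMALL-FIELD DOMAINS THEMSELVES AS BOOKKEEPING SETS:
# `D j := domAltOfRecord θ.ν K j` («|∂V − 1| < ε₀», [Balaban1987RG1] p. 259); openness ∕ measurability ∕ gauge-stability ∕ top membership ∕ nesting are THEOREMS,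
# the support clause is the THRESHOLD HIERARCHY, and the analytic content is ONE inclusion per step «`domAlt_{j+1} ⊆ regSet_j(ρ_j)`» ([I] p. 259 «effective actions for small fields»)

TRACK A (YM-PLAN §2b, node N09 of 28 = [B12] = [Balaban1987RG1] (CMP 109) Thm 3 p. 264 + Lemma 4 p. 280), WIDTH SEAT `pub-ymgap-dag-n09-w3` (g2; HUMAN RULING D-0149,
director-ym №197), FILE 2.  Key of record it serves: K1⁷ `StabilityBAtRecordR13SepCoPH` = stmt-QuantumFields-20542 (`--supports`, count-neutral helper).  A NEW importing
module over this seat's FILE 1 `…N09NestingFromSupport`, dag-n09-w1 g2's `…N09HeredModFineOfThm1` (⇒ `…N09BackgroundRadiiTransfer` p594365) and dag-n21-c's `…N21AveragedDatumRegularity`; THEOREMS ONLY, def-free, sorry-free, standard axioms.  [I] = [Balaban1987RG1], [B11] = [Balaban1985Variational],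
[III] = [Balaban1988Convergent], [IV] = [Balaban1989LargeFieldI].

WHY.  dag-n09-w2's localised junction (p591459; consumed run by run by dag-n24-c's 24H ∕ Part 20 with a FREE family `D09 P` and thirteen located N09 families
`D09 h09cov h09Dsol h09Do h09Dm h09Dst h09supp h09int h09reg h07sol h07res h07uniq h09nest`) leaves the CHOICE of the bookkeeping sets open; its located note asks
«WHICH sets `D (j+1)` — open, gauge-stable, inside `regSetOfRecord K j ρ_j` AND inside the solvable set at radius `θ.ν.εreg`, receive the nested averaged minimisers, and
carry the localised support clause (for `χ^{(2.9)}`: K0e's threshold hierarchy points at the small-field domains)».  This seat's g0 `…OnDomains` took `D (j+1) := regSet_j ∩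
domAlt_{j+1}` (so `hreg` is free and the nesting ∕ the top membership carry the analytic content).  THIS FILE takes the OTHER natural choice — THE SMALL-FIELD DOMAINS
THEMSELVES, `D j := domAltOfRecord θ.ν K j` at EVERY level `j ≥ 0` — and records what it buys, all as theorems over FILE 1's `…_of_stepsOnLoc_of_orbitRel`:
`hDo` (dag-n09-a `isOpen_domAltOfRecord`), `hDm` (def-χ `measurableSet_domAltOfRecord`), `hDst` ∕ `hD0st` (dag-n09-a `domAltOfRecord_gaugeAct_mem`), `htop` (TRIVIAL:
`V ∈ domAlt_k` is the door's own range of `V`), `hnest` (FILE 1: from the support clause + stability + [B11]'s one-orbit clause).  What stays DISPLAYED, each ONE named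
print sentence: (181)ˢᵒˡ `hcov`; `hsolν` «the small-field domain is solvable at the cut-off's radius» ([B11] Thm 1 existence at `θ.ν.εreg`; dag-n09-w1 g2's
`ukExists_εreg_of_h11_of_reg8` supplies it from `h11` + one (8)-clause + `εreg ≤ εbg`, §3); the support clause AT THE DOMAINS `hχdom` «`Ū U ∈ domAlt_{j+1}`, `χ^{(2.9)}_j(U) ≠ 0`
⇒ `U ∈ domAlt_j`» = K0e's THRESHOLD HIERARCHY ([III] p. 265 l. 31–32 ∕ [IV] Prop 1 (1.78)): §1 derives it from the Prop-2 [12] plaquette smallness of the critical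
configurations over small fields (`hcrit`), the p. 266–267 rider on the `b₀(c)`-variables (`hb0`) and the threshold ordering `δ + 4·max(ε₂₉, ε′) ≤ ε₀` (`hord`); (I19)
`hint`; THE analytic binder `hreg : domAlt_{j+1} ⊆ regSetOfRecord K j ρ_j` — «the transform of the (0.19) density has a continuous version on the small-field domain»,
[I] p. 259 «effective actions for small fields», K0e's `domAlt_subset_regSetOfRecord` face (located debts (F1)–(F3) of `P7-LOCATOR-AUDIT.md`); [B11] ×3 `h11 ∕ hres ∕ huniq`
at `θ.εbg`; the one-orbit clause `horb` (the door's own `hres` + `huniq` at one radius, FILE 1 §3; dag-n09-w1 g2's mixed-radii lemma at the record's two radii); `0 < θ.ε₂₉`.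
So at the small-field bookkeeping N09's located list has NO free set family and TEN families instead of thirteen, of which exactly TWO are analytic (`hreg`, `hint`),
ONE is the selection property (`hcov`), and the rest are [B11] Thm 1 ∕ [12] Prop 2 ∕ numeric-window sentences.

WHAT THIS FILE PROVES (12 theorems).  §1 `hχdom_of_crit_of_rider` (the support clause at the domains from the threshold hierarchy), `hcrit_of_ukExists` (its Prop-2 input IS
dag-n21-c's [B7] Prop. 2 theorem at the record, modulo three numerics on `εreg`).  §2 ★★ `thm3Member_stage13SepCoPH_atDomAlt_of_orbitRel`,
`b12_main_stage13SepCoPH_of_leaf_atDomAlt_of_orbitRel`, `thm3Member_forall_stage13SepCoPH_atDomAlt_of_orbitRel` (`∀ P` shape).  §3 ★★ `thm3Member_stage13SepCoPH_atDomAlt_of_εreg_eq`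
(ONE radius: `horb` is the door's own `hres` + `huniq`), `thm3Member_stage13SepCoPH_atDomAlt_of_orbitRel_of_reg8` (`hsolν` ↦ dag-n09-w1 g2's `hreg8` + `hle`), ★★★ `thm3Member_stage13SepCoPH_atDomAlt_of_thm1_of_reg8` ∕
`b12_main_stage13SepCoPH_of_leaf_atDomAlt_of_thm1_of_reg8` (THE TWO-RADII DOOR OF RECORD: `horb` AND `hsolν` both ↦ dag-n09-w1 g2's theorems from [B11]×3 + `hreg8` + `0 ≤ εreg ≤ εbg`),
`thm3Member_stage13SepCoPH_atDomAlt_of_crit_of_rider_of_εreg_eq` (one radius AND the support clause opened to `hcrit` + `hb0` + `hord`: the door's N09-side list is then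
`hcov`, `hsolν`, `hcrit`, `hb0`, `hord`, `hint`, `hreg`, `h11 ∕ hres ∕ huniq`, `hε` — every item ONE print sentence or ONE numeric inequality),
★★★ `thm3Member_stage13SepCoPH_atDomAlt_of_rider_of_numerics_of_εreg_eq` (`hcrit` supplied too: N09-side inputs = `hcov`, `hsolν`, `hb0`, numerics, `hint`, `hreg`, [B11]×3).
§4 `thm3Member_stage13SepCoPH_atDomAlt_of_contTOn` (`hreg` ↦ K0e ∕ def-T's on-domain β-version proviso `HasContTransportOn K j ρ_j (domAlt_{j+1})`, by `domAlt_subset_regSetOfRecord`).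

HONEST FRAMING: count-neutral kernel bookkeeping BY NAME (FILE 1, dag-n09-w2's junction, dag-n09-a's ∕ def-χ's ∕ K0e's domain lemmas, dag-n09-w1 g2's radius transfer); NO
estimate of Bałaban's is proved; every displayed hypothesis is located in print and none is asserted; A6: the set-side binders are DISCHARGED here (not displayed), the
remaining ones are print's sentences at the record — the filing is a REDUCTION, no inhabitant at the V18∕V19 witness is claimed; N09 NOT discharged; conjunct 1 (Lemma 4, the
leaf `b12`) untouched; K0⁷ ∕ K1⁷ NOT closed; counts unmoved (typed 28∕28 · discharged 5∕27); one finite four-torus programme at fixed `ε = L^{−K}` per run — R4 closes the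
conditional rung `BalabanLadder.UV` only; NOT ℝ⁴, NOT infinite volume, NOT OS, NOT a mass gap; the Yang–Mills mass gap (Clay) is NOT proved by any of this.
-/

noncomputable section

namespace Summit.QuantumFields.YangMills.BalabanUVNodes.N09AtSmallFieldBookkeeping

open MeasureTheory Set
open Literature.MathematicalPhysics.QuantumFieldTheory.Balaban1983to89
open Literature.MathematicalPhysics.QuantumFieldTheory.Balaban1983to89.T4Continuum (T4Family)
open Literature.MathematicalPhysics.QuantumFieldTheory.Balaban1983to89.DagBinding (WorldP leavesP)
open Literature.MathematicalPhysics.QuantumFieldTheory.Balaban1983to89.Node00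
open Literature.MathematicalPhysics.QuantumFieldTheory.Balaban1983to89.B12RTGaugeInvariance254 (liftTransf)
open Literature.MathematicalPhysics.QuantumFieldTheory.Balaban1983to89.GaugeField (gaugeAct)
open Literature.MathematicalPhysics.QuantumFieldTheory.Balaban1983to89.B12GaugeOrbits021 (OrbitRel)
open Literature.MathematicalPhysics.QuantumFieldTheory.Balaban1983to89.B12ContinuousTransportInvarianceOn (isOpen_domAltOfRecord domAltOfRecord_gaugeAct_mem)
open Literature.MathematicalPhysics.QuantumFieldTheory.Balaban1983to89.B12NodeKnitRecord8 (b12_main_of_leaf_of_thm3Member)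
open N09NestingFromSupport (thm3Member_stage13SepCoPH_of_stepsOnLoc_of_orbitRel horb_of_hRestrict_of_unique_of_εreg_eq)
open N09BackgroundRadiiTransfer (ukExists_εreg_of_h11_of_reg8)
open N09HeredModFineOfThm1 (orbitRel_Uk_UkSucc_iter_of_thm1_εbg_of_reg8)
open Literature.MathematicalPhysics.QuantumFieldTheory.Balaban1983to89.ExpMeanLog (deltaSU)
open Summit.QuantumFields.YangMills.Theorems.N21AveragedDatumRegularity (plaqSmall_iter_Uk_level)

variable {F : T4Family} {N : ℕ} [NeZero N]

/-! ## §1. The localised support clause AT THE SMALL-FIELD DOMAINS is K0e's threshold hierarchy -/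

/-- **THE SUPPORT CLAUSE AT THE DOMAINS FROM THE THRESHOLD HIERARCHY** ([III] p. 265 l. 31–32 «on Ω^∼_{k+1} the functions χ_{Λ_k} and χ_k are equal to 1» ∕ [IV] Prop 1
(1.78), K0e `mem_domAltOfRecord_of_chiFix29_eq_one`): if the critical configurations (2.3) over small fields have `δ`-small plaquettes (`hcrit` — Prop 2 [12] ∕ [B11] Thm 1
(9)–(10), DISPLAYED), the excluded `b₀(c)`-variables obey the p. 266–267 rider wherever `χ^{(2.9)}_j = 1` over a small field (`hb0`, DISPLAYED), and the thresholds are ordered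
(`δ + 4·max(ε₂₉, ε′) ≤ ε₀`), then a step-`j` field `U` with `Ū U ∈ domAlt_{j+1}` and `χ^{(2.9)}_j(U) ≠ 0` lies in `domAlt_j` — the junction's `hχD` at `D := domAltOfRecord θ₀.ν K`.
[cite: Balaban1988Convergent, p.265; Balaban1989LargeFieldI, Prop. 1 (1.78) p.194; Balaban1987RG1, (2.9) p.266 and p.267] -/
theorem hχdom_of_crit_of_rider (θ₀ : Stage13Params F N) (K : ℕ) (g : ℕ → ℝ) {δ ε' : ℝ} (hord : δ + 4 * max θ₀.ε₂₉ ε' ≤ θ₀.ν.ε₀)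
    (hcrit : ∀ j < K, ∀ W ∈ domAltOfRecord F N θ₀.ν K (j + 1), PlaqSmall δ (critCfgOfRecord F N θ₀.ν K j W))
    (hb0 : ∀ j < K, ∀ U : GaugeField (F.P K) j (SU N), (avOfRecord F N K j).avg U ∈ domAltOfRecord F N θ₀.ν K (j + 1) →
      chiβOfRecord₁₃ F N θ₀ K g j U = 1 → ∀ b : PBond (F.P K) j, IsB0 b → fluctDevOfRecord F N θ₀.ν K j U b ≤ ε') :
    ∀ j < K, ∀ U : GaugeField (F.P K) j (SU N), (avOfRecord F N K j).avg U ∈ domAltOfRecord F N θ₀.ν K (j + 1) →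
      U ∉ domAltOfRecord F N θ₀.ν K j → chiβOfRecord₁₃ F N θ₀ K g j U = 0 := by
  intro j hj U havg hnot
  rcases chiFix29OfRecord_eq_zero_or_one θ₀.ν θ₀.ε₂₉ K j U with h0 | h1
  · exact h0
  · exact absurd (mem_domAltOfRecord_of_chiFix29_eq_one h1 (hb0 j hj U havg h1) (hcrit j hj _ havg) hord) hnot

/-- **THE Prop-2 INPUT `hcrit` IS A TREE THEOREM AT THE RECORD, modulo numerics**: for a SOLVABLE small field `W ∈ domAlt_{j+1}` (radius `ν.εreg`) the critical
configuration `V^{(j)}(W) = M^j(U_{j+1}(W))` has `(2εreg∕L²)`-small plaquettes — [B7] Prop. 2 (52) ⇒ (54) for the averaging of record, uniform in the level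
(dag-n21-c's `N21AveragedDatumRegularity.plaqSmall_iter_Uk_level` BY NAME at `(k, ε) := (j+1, ν.εreg)`, level `j`: `(L^j·η_{j+1})² = L⁻²`), under its three numeric
side conditions on `ν.εreg` (`0 < εreg`, `C₀(d)·εreg ≤ ⅓`, `2εreg ≤ 2δ_N∕((d+4)L)²`). [cite: Balaban1985Averaging, Prop. 2 (52)–(54) p.26; Balaban1987RG1, (2.3) p.265] -/
theorem hcrit_of_ukExists (ν : Stage7Numerics) (K : ℕ) (hε : 0 < ν.εreg)
    (hε3 : (143 * (((((F.P K).d + 4 : ℕ) : ℝ)) ^ 2 / 4) ^ 2) * ν.εreg ≤ 1 / 3)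
    (hε2 : 2 * ν.εreg ≤ 2 * deltaSU (Fin N) / ((((F.P K).d + 4) * (F.P K).L : ℕ) : ℝ) ^ 2)
    (hsolν : ∀ j < K, ∀ W ∈ domAltOfRecord F N ν K (j + 1), UkExists F N K (j + 1) ν.εreg W) :
    ∀ j < K, ∀ W ∈ domAltOfRecord F N ν K (j + 1), PlaqSmall (2 * ν.εreg / ((F.P K).L : ℝ) ^ 2) (critCfgOfRecord F N ν K j W) := by
  intro j hj W hW p
  have hL0 : ((F.P K).L : ℝ) ≠ 0 := Nat.cast_ne_zero.mpr (ne_of_gt (F.P K).L_pos)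
  have hL : ((F.P K).L : ℝ) ^ j * (F.P K).eta (j + 1) = (((F.P K).L : ℝ))⁻¹ := by
    rw [Params.eta, inv_pow, pow_succ, mul_inv, ← mul_assoc, mul_inv_cancel₀ (pow_ne_zero _ hL0), one_mul]
  have h := plaqSmall_iter_Uk_level (F := F) (N := N) K (j + 1) hε hε3 hε2 (hsolν j hj W hW) (Nat.le_succ j) p
  rw [hL, inv_pow] at h
  rw [critCfgOfRecord_def, div_eq_mul_inv]
  exact h

/-! ## §2. The localised door at `D := domAltOfRecord θ.ν K`: set-side binders, top membership and nesting DISCHARGED -/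

/-- ★★ **THE THEOREM-3 MEMBER AT THE STAGE-13 v1.7 CONSTRUCTION WITH THE SMALL-FIELD DOMAINS AS BOOKKEEPING SETS**: FILE 1's
`thm3Member_stage13SepCoPH_of_stepsOnLoc_of_orbitRel` at `D j := domAltOfRecord θ.ν P.K j` — `hDo` ∕ `hDm` ∕ `hDst` ∕ `hD0st` by dag-n09-a's ∕ def-χ's domain lemmas, `htop` by
`id`, `hnest` by FILE 1.  DISPLAYED (each located): (181)ˢᵒˡ `hcov`; `hsolν` (the domain is solvable at `θ.ν.εreg`, [B11] Thm 1); the support clause at the domains `hχdom`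
(§1 opens it to Prop 2 [12] + the rider + the threshold ordering); (I19) `hint`; THE analytic inclusion `hreg : domAlt_{j+1} ⊆ regSetOfRecord K j ρ_j` ([I] p. 259 «effective actions
for small fields»; K0e `domAlt_subset_regSetOfRecord` species); [B11] ×3 `h11 ∕ hres ∕ huniq` at `θ.εbg`; the one-orbit clause `horb`; `0 < θ.ε₂₉`.  NO free set family, NO
nesting binder, NO hereditary selection, NO axial convention.  CONDITIONAL; nothing of Bałaban asserted; N09 NOT discharged.
[cite: Balaban1987RG1, Thm 3 p.264, p.259, (1.1)–(1.3) p.260, (0.13) p.254, (2.1)–(2.3) p.265, (2.9)–(2.10) pp.266–267; Balaban1985Variational, Thm 1 (8)–(10) p.279 and (181) p.307] -/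
theorem thm3Member_stage13SepCoPH_atDomAlt_of_orbitRel (θ : Stage13HParams F N) (h : θ.Provisos₁₃SepCoPH F N) {w : WorldP}
    (hC : w.C = (datumOfRecord₁₃SepCoPH F N θ h).C) (P : B12.RunParams) (hε : 0 < θ.ε₂₉)
    (hcov : ∀ j < P.K, ∀ (v : GaugeTransf (F.P P.K) (j + 1) (SU N)) (W : GaugeField (F.P P.K) (j + 1) (SU N)),
      UkExists F N P.K (j + 1) θ.toStage13Params.ν.εreg W →
        critCfgOfRecord F N θ.toStage13Params.ν P.K j (gaugeAct v W) = gaugeAct (liftTransf v) (critCfgOfRecord F N θ.toStage13Params.ν P.K j W))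
    (hsolν : ∀ j < P.K, ∀ W ∈ domAltOfRecord F N θ.ν P.K (j + 1), UkExists F N P.K (j + 1) θ.toStage13Params.ν.εreg W)
    (hχdom : ∀ j < P.K, ∀ U : GaugeField (F.P P.K) j (SU N), (avOfRecord F N P.K j).avg U ∈ domAltOfRecord F N θ.ν P.K (j + 1) →
      U ∉ domAltOfRecord F N θ.ν P.K j → chiβOfRecord₁₃ F N θ.toStage13Params P.K (gOfRecord₁₃ F N θ.toStage13Params P) j U = 0)
    (hint : ∀ j < P.K, Integrable (betaInputOfRecord F N (TβOfRecord₁₃ F N) (chiβOfRecord₁₃ F N θ.toStage13Params) P.K (gOfRecord₁₃ F N θ.toStage13Params P) j)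
      (fieldMeasure (F.P P.K) j (SU N)))
    (hreg : ∀ j < P.K, domAltOfRecord F N θ.ν P.K (j + 1) ⊆ regSetOfRecord F N P.K j
      (betaInputOfRecord F N (TβOfRecord₁₃ F N) (chiβOfRecord₁₃ F N θ.toStage13Params) P.K (gOfRecord₁₃ F N θ.toStage13Params P) j))
    (h11 : ∀ k, k ≤ P.K → ∀ V ∈ domAltOfRecord F N θ.ν P.K k, UkExists F N P.K k θ.εbg V ∧ UniqueUkOrbit F N P.K k θ.εbg V)
    (hres : ∀ k, k ≤ P.K → HRestrict F N θ.εbg P.K k (domAltOfRecord F N θ.ν P.K k))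
    (huniq : ∀ k, k ≤ P.K → ∀ V ∈ domAltOfRecord F N θ.ν P.K k, ∀ j < k,
      UniqueUkOrbit F N P.K (j + 1) θ.εbg (Averaging.iter (avOfRecord F N P.K) (j + 1) (Uk F N P.K k θ.εbg V)))
    (horb : ∀ k, k ≤ P.K → ∀ V ∈ domAltOfRecord F N θ.ν P.K k, ∀ j < k, OrbitRel (j + 1) (Uk F N P.K k θ.εbg V)
      (Uk F N P.K (j + 1) θ.toStage13Params.ν.εreg (Averaging.iter (avOfRecord F N P.K) (j + 1) (Uk F N P.K k θ.εbg V)))) :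
    (leavesP w P).smallCouplings → (leavesP w P).smallFieldInductive :=
  thm3Member_stage13SepCoPH_of_stepsOnLoc_of_orbitRel θ h hC P (fun j => domAltOfRecord F N θ.ν P.K j) hε hcov hsolν
    (fun j _ => isOpen_domAltOfRecord θ.ν P.K (j + 1)) (fun j _ => measurableSet_domAltOfRecord θ.ν P.K (j + 1))
    (fun j _ v V hV => domAltOfRecord_gaugeAct_mem θ.ν P.K (j + 1) v V hV) (fun u U hU => domAltOfRecord_gaugeAct_mem θ.ν P.K 0 u U hU)
    hχdom hint hreg h11 hres huniq horb (fun _ _ _ hV => hV)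

/-- **N09 AT `(w, P)` WITH THE SMALL-FIELD DOMAINS AS BOOKKEEPING SETS**: own leaf `b12` ([I] Lemma 4) + the inputs of `thm3Member_stage13SepCoPH_atDomAlt_of_orbitRel` ⇒
`Dag.B12_main (leavesP w P)`.  CONDITIONAL; N09 NOT discharged.
[cite: Balaban1987RG1, Lemma 4 (3.53) p.280, Thm 3 p.264, p.259, (1.1)–(1.3) p.260, (2.1)–(2.3) p.265 and (2.9) p.266; Balaban1985Variational, Thm 1 p.279 and (181) p.307] -/
theorem b12_main_stage13SepCoPH_of_leaf_atDomAlt_of_orbitRel (θ : Stage13HParams F N) (h : θ.Provisos₁₃SepCoPH F N) {w : WorldP}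
    (hC : w.C = (datumOfRecord₁₃SepCoPH F N θ h).C) (P : B12.RunParams) (h12 : (leavesP w P).b12) (hε : 0 < θ.ε₂₉)
    (hcov : ∀ j < P.K, ∀ (v : GaugeTransf (F.P P.K) (j + 1) (SU N)) (W : GaugeField (F.P P.K) (j + 1) (SU N)),
      UkExists F N P.K (j + 1) θ.toStage13Params.ν.εreg W →
        critCfgOfRecord F N θ.toStage13Params.ν P.K j (gaugeAct v W) = gaugeAct (liftTransf v) (critCfgOfRecord F N θ.toStage13Params.ν P.K j W))
    (hsolν : ∀ j < P.K, ∀ W ∈ domAltOfRecord F N θ.ν P.K (j + 1), UkExists F N P.K (j + 1) θ.toStage13Params.ν.εreg W)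
    (hχdom : ∀ j < P.K, ∀ U : GaugeField (F.P P.K) j (SU N), (avOfRecord F N P.K j).avg U ∈ domAltOfRecord F N θ.ν P.K (j + 1) →
      U ∉ domAltOfRecord F N θ.ν P.K j → chiβOfRecord₁₃ F N θ.toStage13Params P.K (gOfRecord₁₃ F N θ.toStage13Params P) j U = 0)
    (hint : ∀ j < P.K, Integrable (betaInputOfRecord F N (TβOfRecord₁₃ F N) (chiβOfRecord₁₃ F N θ.toStage13Params) P.K (gOfRecord₁₃ F N θ.toStage13Params P) j)
      (fieldMeasure (F.P P.K) j (SU N)))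
    (hreg : ∀ j < P.K, domAltOfRecord F N θ.ν P.K (j + 1) ⊆ regSetOfRecord F N P.K j
      (betaInputOfRecord F N (TβOfRecord₁₃ F N) (chiβOfRecord₁₃ F N θ.toStage13Params) P.K (gOfRecord₁₃ F N θ.toStage13Params P) j))
    (h11 : ∀ k, k ≤ P.K → ∀ V ∈ domAltOfRecord F N θ.ν P.K k, UkExists F N P.K k θ.εbg V ∧ UniqueUkOrbit F N P.K k θ.εbg V)
    (hres : ∀ k, k ≤ P.K → HRestrict F N θ.εbg P.K k (domAltOfRecord F N θ.ν P.K k))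
    (huniq : ∀ k, k ≤ P.K → ∀ V ∈ domAltOfRecord F N θ.ν P.K k, ∀ j < k,
      UniqueUkOrbit F N P.K (j + 1) θ.εbg (Averaging.iter (avOfRecord F N P.K) (j + 1) (Uk F N P.K k θ.εbg V)))
    (horb : ∀ k, k ≤ P.K → ∀ V ∈ domAltOfRecord F N θ.ν P.K k, ∀ j < k, OrbitRel (j + 1) (Uk F N P.K k θ.εbg V)
      (Uk F N P.K (j + 1) θ.toStage13Params.ν.εreg (Averaging.iter (avOfRecord F N P.K) (j + 1) (Uk F N P.K k θ.εbg V)))) :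
    Dag.B12_main (leavesP w P) :=
  b12_main_of_leaf_of_thm3Member h12
    (thm3Member_stage13SepCoPH_atDomAlt_of_orbitRel θ h hC P hε hcov hsolν hχdom hint hreg h11 hres huniq horb)

/-- **THE `∀ P` FORM = N24's `h09T` WITH THE SMALL-FIELD DOMAINS AS BOOKKEEPING SETS** (no `D09` family to pass; N09's located inputs are the ten families of
`thm3Member_stage13SepCoPH_atDomAlt_of_orbitRel`, run by run).  CONDITIONAL; N09 NOT discharged; K1⁷ NOT closed.
[cite: Balaban1987RG1, Thm 3 p.264, p.259, (1.1)–(1.3) p.260, (2.1)–(2.3) p.265, (2.9)–(2.10) pp.266–267; Balaban1985Variational, Thm 1 (8)–(10) p.279 and (181) p.307] -/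
theorem thm3Member_forall_stage13SepCoPH_atDomAlt_of_orbitRel (θ : Stage13HParams F N) (h : θ.Provisos₁₃SepCoPH F N) {w : WorldP}
    (hC : w.C = (datumOfRecord₁₃SepCoPH F N θ h).C) (hε : 0 < θ.ε₂₉)
    (hcov : ∀ (P : B12.RunParams), ∀ j < P.K, ∀ (v : GaugeTransf (F.P P.K) (j + 1) (SU N)) (W : GaugeField (F.P P.K) (j + 1) (SU N)),
      UkExists F N P.K (j + 1) θ.toStage13Params.ν.εreg W →
        critCfgOfRecord F N θ.toStage13Params.ν P.K j (gaugeAct v W) = gaugeAct (liftTransf v) (critCfgOfRecord F N θ.toStage13Params.ν P.K j W))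
    (hsolν : ∀ (P : B12.RunParams), ∀ j < P.K, ∀ W ∈ domAltOfRecord F N θ.ν P.K (j + 1), UkExists F N P.K (j + 1) θ.toStage13Params.ν.εreg W)
    (hχdom : ∀ (P : B12.RunParams), ∀ j < P.K, ∀ U : GaugeField (F.P P.K) j (SU N), (avOfRecord F N P.K j).avg U ∈ domAltOfRecord F N θ.ν P.K (j + 1) →
      U ∉ domAltOfRecord F N θ.ν P.K j → chiβOfRecord₁₃ F N θ.toStage13Params P.K (gOfRecord₁₃ F N θ.toStage13Params P) j U = 0)
    (hint : ∀ (P : B12.RunParams), ∀ j < P.K, Integrable (betaInputOfRecord F N (TβOfRecord₁₃ F N) (chiβOfRecord₁₃ F N θ.toStage13Params) P.K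
      (gOfRecord₁₃ F N θ.toStage13Params P) j) (fieldMeasure (F.P P.K) j (SU N)))
    (hreg : ∀ (P : B12.RunParams), ∀ j < P.K, domAltOfRecord F N θ.ν P.K (j + 1) ⊆ regSetOfRecord F N P.K j
      (betaInputOfRecord F N (TβOfRecord₁₃ F N) (chiβOfRecord₁₃ F N θ.toStage13Params) P.K (gOfRecord₁₃ F N θ.toStage13Params P) j))
    (h11 : ∀ (P : B12.RunParams) (k : ℕ), k ≤ P.K → ∀ V ∈ domAltOfRecord F N θ.ν P.K k, UkExists F N P.K k θ.εbg V ∧ UniqueUkOrbit F N P.K k θ.εbg V)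
    (hres : ∀ (P : B12.RunParams) (k : ℕ), k ≤ P.K → HRestrict F N θ.εbg P.K k (domAltOfRecord F N θ.ν P.K k))
    (huniq : ∀ (P : B12.RunParams) (k : ℕ), k ≤ P.K → ∀ V ∈ domAltOfRecord F N θ.ν P.K k, ∀ j < k,
      UniqueUkOrbit F N P.K (j + 1) θ.εbg (Averaging.iter (avOfRecord F N P.K) (j + 1) (Uk F N P.K k θ.εbg V)))
    (horb : ∀ (P : B12.RunParams) (k : ℕ), k ≤ P.K → ∀ V ∈ domAltOfRecord F N θ.ν P.K k, ∀ j < k, OrbitRel (j + 1) (Uk F N P.K k θ.εbg V)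
      (Uk F N P.K (j + 1) θ.toStage13Params.ν.εreg (Averaging.iter (avOfRecord F N P.K) (j + 1) (Uk F N P.K k θ.εbg V)))) :
    ∀ P : B12.RunParams, (leavesP w P).smallCouplings → (leavesP w P).smallFieldInductive :=
  fun P => thm3Member_stage13SepCoPH_atDomAlt_of_orbitRel θ h hC P hε (hcov P) (hsolν P) (hχdom P) (hint P) (hreg P) (h11 P) (hres P) (huniq P) (horb P)

/-! ## §3. One radius; the solvability of the domain from dag-n09-w1 g2's radius transfer; the support clause opened -/

/-- ★★ **ONE RADIUS (`θ.ν.εreg = θ.εbg`): the small-field-bookkeeping door with the one-orbit clause supplied by the door's own `hres` + `huniq`** (FILE 1 §3).  N09's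
located list: `hcov`, `hsolν`, `hχdom`, `hint`, `hreg`, `h11 ∕ hres ∕ huniq`, `hε`.  CONDITIONAL; nothing of Bałaban asserted; N09 NOT discharged.
[cite: Balaban1987RG1, Thm 3 p.264, p.259, (1.1)–(1.3) p.260, (2.1)–(2.3) p.265, (2.9)–(2.10) pp.266–267; Balaban1985Variational, Thm 1 (8)–(10) p.279 and (181) p.307] -/
theorem thm3Member_stage13SepCoPH_atDomAlt_of_εreg_eq (θ : Stage13HParams F N) (h : θ.Provisos₁₃SepCoPH F N) {w : WorldP}
    (hC : w.C = (datumOfRecord₁₃SepCoPH F N θ h).C) (P : B12.RunParams) (hε : 0 < θ.ε₂₉) (heq : θ.toStage13Params.ν.εreg = θ.εbg)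
    (hcov : ∀ j < P.K, ∀ (v : GaugeTransf (F.P P.K) (j + 1) (SU N)) (W : GaugeField (F.P P.K) (j + 1) (SU N)),
      UkExists F N P.K (j + 1) θ.toStage13Params.ν.εreg W →
        critCfgOfRecord F N θ.toStage13Params.ν P.K j (gaugeAct v W) = gaugeAct (liftTransf v) (critCfgOfRecord F N θ.toStage13Params.ν P.K j W))
    (hsolν : ∀ j < P.K, ∀ W ∈ domAltOfRecord F N θ.ν P.K (j + 1), UkExists F N P.K (j + 1) θ.toStage13Params.ν.εreg W)
    (hχdom : ∀ j < P.K, ∀ U : GaugeField (F.P P.K) j (SU N), (avOfRecord F N P.K j).avg U ∈ domAltOfRecord F N θ.ν P.K (j + 1) →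
      U ∉ domAltOfRecord F N θ.ν P.K j → chiβOfRecord₁₃ F N θ.toStage13Params P.K (gOfRecord₁₃ F N θ.toStage13Params P) j U = 0)
    (hint : ∀ j < P.K, Integrable (betaInputOfRecord F N (TβOfRecord₁₃ F N) (chiβOfRecord₁₃ F N θ.toStage13Params) P.K (gOfRecord₁₃ F N θ.toStage13Params P) j)
      (fieldMeasure (F.P P.K) j (SU N)))
    (hreg : ∀ j < P.K, domAltOfRecord F N θ.ν P.K (j + 1) ⊆ regSetOfRecord F N P.K j
      (betaInputOfRecord F N (TβOfRecord₁₃ F N) (chiβOfRecord₁₃ F N θ.toStage13Params) P.K (gOfRecord₁₃ F N θ.toStage13Params P) j))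
    (h11 : ∀ k, k ≤ P.K → ∀ V ∈ domAltOfRecord F N θ.ν P.K k, UkExists F N P.K k θ.εbg V ∧ UniqueUkOrbit F N P.K k θ.εbg V)
    (hres : ∀ k, k ≤ P.K → HRestrict F N θ.εbg P.K k (domAltOfRecord F N θ.ν P.K k))
    (huniq : ∀ k, k ≤ P.K → ∀ V ∈ domAltOfRecord F N θ.ν P.K k, ∀ j < k,
      UniqueUkOrbit F N P.K (j + 1) θ.εbg (Averaging.iter (avOfRecord F N P.K) (j + 1) (Uk F N P.K k θ.εbg V))) :
    (leavesP w P).smallCouplings → (leavesP w P).smallFieldInductive :=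
  thm3Member_stage13SepCoPH_atDomAlt_of_orbitRel θ h hC P hε hcov hsolν hχdom hint hreg h11 hres huniq
    (horb_of_hRestrict_of_unique_of_εreg_eq θ P heq hres huniq)

/-- **THE SOLVABILITY OF THE DOMAIN FROM dag-n09-w1 g2's RADIUS TRANSFER**: the small-field-bookkeeping door with `hsolν` REPLACED by the door's own `h11` + the located
(8)-membership `hreg8` («the radius-`εbg` background of a small field is `εreg`-regular», [B11] Thm 1 (8)) + `εreg ≤ εbg` (`…N09BackgroundRadiiTransfer.ukExists_εreg_of_h11_of_reg8`,
p594365, by name).  CONDITIONAL; nothing of Bałaban asserted; N09 NOT discharged.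
[cite: Balaban1987RG1, Thm 3 p.264, p.259, (1.1)–(1.3) p.260, (2.1)–(2.3) p.265; Balaban1985Variational, Thm 1 (8)–(10) p.279 and (181) p.307] -/
theorem thm3Member_stage13SepCoPH_atDomAlt_of_orbitRel_of_reg8 (θ : Stage13HParams F N) (h : θ.Provisos₁₃SepCoPH F N) {w : WorldP}
    (hC : w.C = (datumOfRecord₁₃SepCoPH F N θ h).C) (P : B12.RunParams) (hε : 0 < θ.ε₂₉)
    (hreg8 : ∀ k, k ≤ P.K → ∀ V ∈ domAltOfRecord F N θ.ν P.K k, Uk F N P.K k θ.εbg V ∈ bgReg F N P.K k θ.toStage13Params.ν.εreg)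
    (hle : θ.toStage13Params.ν.εreg ≤ θ.εbg)
    (hcov : ∀ j < P.K, ∀ (v : GaugeTransf (F.P P.K) (j + 1) (SU N)) (W : GaugeField (F.P P.K) (j + 1) (SU N)),
      UkExists F N P.K (j + 1) θ.toStage13Params.ν.εreg W →
        critCfgOfRecord F N θ.toStage13Params.ν P.K j (gaugeAct v W) = gaugeAct (liftTransf v) (critCfgOfRecord F N θ.toStage13Params.ν P.K j W))
    (hχdom : ∀ j < P.K, ∀ U : GaugeField (F.P P.K) j (SU N), (avOfRecord F N P.K j).avg U ∈ domAltOfRecord F N θ.ν P.K (j + 1) →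
      U ∉ domAltOfRecord F N θ.ν P.K j → chiβOfRecord₁₃ F N θ.toStage13Params P.K (gOfRecord₁₃ F N θ.toStage13Params P) j U = 0)
    (hint : ∀ j < P.K, Integrable (betaInputOfRecord F N (TβOfRecord₁₃ F N) (chiβOfRecord₁₃ F N θ.toStage13Params) P.K (gOfRecord₁₃ F N θ.toStage13Params P) j)
      (fieldMeasure (F.P P.K) j (SU N)))
    (hreg : ∀ j < P.K, domAltOfRecord F N θ.ν P.K (j + 1) ⊆ regSetOfRecord F N P.K j
      (betaInputOfRecord F N (TβOfRecord₁₃ F N) (chiβOfRecord₁₃ F N θ.toStage13Params) P.K (gOfRecord₁₃ F N θ.toStage13Params P) j))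
    (h11 : ∀ k, k ≤ P.K → ∀ V ∈ domAltOfRecord F N θ.ν P.K k, UkExists F N P.K k θ.εbg V ∧ UniqueUkOrbit F N P.K k θ.εbg V)
    (hres : ∀ k, k ≤ P.K → HRestrict F N θ.εbg P.K k (domAltOfRecord F N θ.ν P.K k))
    (huniq : ∀ k, k ≤ P.K → ∀ V ∈ domAltOfRecord F N θ.ν P.K k, ∀ j < k,
      UniqueUkOrbit F N P.K (j + 1) θ.εbg (Averaging.iter (avOfRecord F N P.K) (j + 1) (Uk F N P.K k θ.εbg V)))
    (horb : ∀ k, k ≤ P.K → ∀ V ∈ domAltOfRecord F N θ.ν P.K k, ∀ j < k, OrbitRel (j + 1) (Uk F N P.K k θ.εbg V)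
      (Uk F N P.K (j + 1) θ.toStage13Params.ν.εreg (Averaging.iter (avOfRecord F N P.K) (j + 1) (Uk F N P.K k θ.εbg V)))) :
    (leavesP w P).smallCouplings → (leavesP w P).smallFieldInductive :=
  thm3Member_stage13SepCoPH_atDomAlt_of_orbitRel θ h hC P hε hcov
    (ukExists_εreg_of_h11_of_reg8 θ.toStage13Params.ν θ.εbg P.K h11 hreg8 hle) hχdom hint hreg h11 hres huniq horb

/-- ★★ **ONE RADIUS AND THE SUPPORT CLAUSE OPENED** — the small-field-bookkeeping door whose N09-side inputs are each ONE print sentence or ONE numeric inequality: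
(181)ˢᵒˡ `hcov`; `hsolν` ([B11] Thm 1 existence on the domain at the cut-off's radius); Prop 2 [12] plaquette smallness of the critical configurations over small fields
(`hcrit`); the p. 266–267 rider on the `b₀(c)`-variables (`hb0`); the threshold ordering `δ + 4·max(ε₂₉, ε′) ≤ ε₀` (`hord`); (I19) `hint`; the analytic inclusion `hreg`
([I] p. 259); [B11] ×3 at the one radius; `0 < ε₂₉`.  CONDITIONAL; nothing of Bałaban asserted; N09 NOT discharged.
[cite: Balaban1987RG1, Thm 3 p.264, p.259, (1.1)–(1.3) p.260, (2.1)–(2.3) p.265, (2.9) p.266 and p.267; Balaban1988Convergent, p.265; Balaban1985Variational, Thm 1 (8)–(10) p.279 and (181) p.307] -/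
theorem thm3Member_stage13SepCoPH_atDomAlt_of_crit_of_rider_of_εreg_eq (θ : Stage13HParams F N) (h : θ.Provisos₁₃SepCoPH F N) {w : WorldP}
    (hC : w.C = (datumOfRecord₁₃SepCoPH F N θ h).C) (P : B12.RunParams) (hε : 0 < θ.ε₂₉) (heq : θ.toStage13Params.ν.εreg = θ.εbg) {δ ε' : ℝ}
    (hord : δ + 4 * max θ.toStage13Params.ε₂₉ ε' ≤ θ.toStage13Params.ν.ε₀)
    (hcrit : ∀ j < P.K, ∀ W ∈ domAltOfRecord F N θ.toStage13Params.ν P.K (j + 1), PlaqSmall δ (critCfgOfRecord F N θ.toStage13Params.ν P.K j W))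
    (hb0 : ∀ j < P.K, ∀ U : GaugeField (F.P P.K) j (SU N), (avOfRecord F N P.K j).avg U ∈ domAltOfRecord F N θ.toStage13Params.ν P.K (j + 1) →
      chiβOfRecord₁₃ F N θ.toStage13Params P.K (gOfRecord₁₃ F N θ.toStage13Params P) j U = 1 →
        ∀ b : PBond (F.P P.K) j, IsB0 b → fluctDevOfRecord F N θ.toStage13Params.ν P.K j U b ≤ ε')
    (hcov : ∀ j < P.K, ∀ (v : GaugeTransf (F.P P.K) (j + 1) (SU N)) (W : GaugeField (F.P P.K) (j + 1) (SU N)),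
      UkExists F N P.K (j + 1) θ.toStage13Params.ν.εreg W →
        critCfgOfRecord F N θ.toStage13Params.ν P.K j (gaugeAct v W) = gaugeAct (liftTransf v) (critCfgOfRecord F N θ.toStage13Params.ν P.K j W))
    (hsolν : ∀ j < P.K, ∀ W ∈ domAltOfRecord F N θ.ν P.K (j + 1), UkExists F N P.K (j + 1) θ.toStage13Params.ν.εreg W)
    (hint : ∀ j < P.K, Integrable (betaInputOfRecord F N (TβOfRecord₁₃ F N) (chiβOfRecord₁₃ F N θ.toStage13Params) P.K (gOfRecord₁₃ F N θ.toStage13Params P) j)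
      (fieldMeasure (F.P P.K) j (SU N)))
    (hreg : ∀ j < P.K, domAltOfRecord F N θ.ν P.K (j + 1) ⊆ regSetOfRecord F N P.K j
      (betaInputOfRecord F N (TβOfRecord₁₃ F N) (chiβOfRecord₁₃ F N θ.toStage13Params) P.K (gOfRecord₁₃ F N θ.toStage13Params P) j))
    (h11 : ∀ k, k ≤ P.K → ∀ V ∈ domAltOfRecord F N θ.ν P.K k, UkExists F N P.K k θ.εbg V ∧ UniqueUkOrbit F N P.K k θ.εbg V)
    (hres : ∀ k, k ≤ P.K → HRestrict F N θ.εbg P.K k (domAltOfRecord F N θ.ν P.K k))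
    (huniq : ∀ k, k ≤ P.K → ∀ V ∈ domAltOfRecord F N θ.ν P.K k, ∀ j < k,
      UniqueUkOrbit F N P.K (j + 1) θ.εbg (Averaging.iter (avOfRecord F N P.K) (j + 1) (Uk F N P.K k θ.εbg V))) :
    (leavesP w P).smallCouplings → (leavesP w P).smallFieldInductive :=
  thm3Member_stage13SepCoPH_atDomAlt_of_εreg_eq θ h hC P hε heq hcov hsolν
    (hχdom_of_crit_of_rider θ.toStage13Params P.K (gOfRecord₁₃ F N θ.toStage13Params P) hord hcrit hb0) hint hreg h11 hres huniq

/-- ★★★ **ONE RADIUS, THE SUPPORT CLAUSE OPENED, AND Prop 2 SUPPLIED BY THE TREE** — the small-field-bookkeeping door whose N09-side inputs are: (181)ˢᵒˡ `hcov`;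
`hsolν` ([B11] Thm 1 existence on the domain at the cut-off's radius); the p. 266–267 rider `hb0`; NUMERICS on the record's letters (`0 < εreg`, `C₀(d)·εreg ≤ ⅓`,
`2εreg ≤ 2δ_N∕((d+4)L)²`, `2εreg∕L² + 4·max(ε₂₉, ε′) ≤ ε₀`, `0 < ε₂₉`); (I19) `hint`; the analytic inclusion `hreg` ([I] p. 259); [B11] ×3 at the one radius.  The Prop-2
sentence is dag-n21-c's theorem (`hcrit_of_ukExists`), the threshold hierarchy K0e's, the set-side binders and the nesting this seat's.  CONDITIONAL; nothing of Bałaban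
asserted; N09 NOT discharged.
[cite: Balaban1987RG1, Thm 3 p.264, p.259, (1.1)–(1.3) p.260, (2.1)–(2.3) p.265, (2.9) p.266 and p.267; Balaban1985Averaging, Prop. 2 (52)–(54) p.26; Balaban1988Convergent, p.265; Balaban1985Variational, Thm 1 (8)–(10) p.279 and (181) p.307] -/
theorem thm3Member_stage13SepCoPH_atDomAlt_of_rider_of_numerics_of_εreg_eq (θ : Stage13HParams F N) (h : θ.Provisos₁₃SepCoPH F N) {w : WorldP}
    (hC : w.C = (datumOfRecord₁₃SepCoPH F N θ h).C) (P : B12.RunParams) (hε : 0 < θ.ε₂₉) (heq : θ.toStage13Params.ν.εreg = θ.εbg) {ε' : ℝ}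
    (hεreg : 0 < θ.toStage13Params.ν.εreg)
    (hε3 : (143 * (((((F.P P.K).d + 4 : ℕ) : ℝ)) ^ 2 / 4) ^ 2) * θ.toStage13Params.ν.εreg ≤ 1 / 3)
    (hε2 : 2 * θ.toStage13Params.ν.εreg ≤ 2 * deltaSU (Fin N) / ((((F.P P.K).d + 4) * (F.P P.K).L : ℕ) : ℝ) ^ 2)
    (hord : 2 * θ.toStage13Params.ν.εreg / ((F.P P.K).L : ℝ) ^ 2 + 4 * max θ.toStage13Params.ε₂₉ ε' ≤ θ.toStage13Params.ν.ε₀)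
    (hb0 : ∀ j < P.K, ∀ U : GaugeField (F.P P.K) j (SU N), (avOfRecord F N P.K j).avg U ∈ domAltOfRecord F N θ.toStage13Params.ν P.K (j + 1) →
      chiβOfRecord₁₃ F N θ.toStage13Params P.K (gOfRecord₁₃ F N θ.toStage13Params P) j U = 1 →
        ∀ b : PBond (F.P P.K) j, IsB0 b → fluctDevOfRecord F N θ.toStage13Params.ν P.K j U b ≤ ε')
    (hcov : ∀ j < P.K, ∀ (v : GaugeTransf (F.P P.K) (j + 1) (SU N)) (W : GaugeField (F.P P.K) (j + 1) (SU N)),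
      UkExists F N P.K (j + 1) θ.toStage13Params.ν.εreg W →
        critCfgOfRecord F N θ.toStage13Params.ν P.K j (gaugeAct v W) = gaugeAct (liftTransf v) (critCfgOfRecord F N θ.toStage13Params.ν P.K j W))
    (hsolν : ∀ j < P.K, ∀ W ∈ domAltOfRecord F N θ.ν P.K (j + 1), UkExists F N P.K (j + 1) θ.toStage13Params.ν.εreg W)
    (hint : ∀ j < P.K, Integrable (betaInputOfRecord F N (TβOfRecord₁₃ F N) (chiβOfRecord₁₃ F N θ.toStage13Params) P.K (gOfRecord₁₃ F N θ.toStage13Params P) j)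
      (fieldMeasure (F.P P.K) j (SU N)))
    (hreg : ∀ j < P.K, domAltOfRecord F N θ.ν P.K (j + 1) ⊆ regSetOfRecord F N P.K j
      (betaInputOfRecord F N (TβOfRecord₁₃ F N) (chiβOfRecord₁₃ F N θ.toStage13Params) P.K (gOfRecord₁₃ F N θ.toStage13Params P) j))
    (h11 : ∀ k, k ≤ P.K → ∀ V ∈ domAltOfRecord F N θ.ν P.K k, UkExists F N P.K k θ.εbg V ∧ UniqueUkOrbit F N P.K k θ.εbg V)
    (hres : ∀ k, k ≤ P.K → HRestrict F N θ.εbg P.K k (domAltOfRecord F N θ.ν P.K k))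
    (huniq : ∀ k, k ≤ P.K → ∀ V ∈ domAltOfRecord F N θ.ν P.K k, ∀ j < k,
      UniqueUkOrbit F N P.K (j + 1) θ.εbg (Averaging.iter (avOfRecord F N P.K) (j + 1) (Uk F N P.K k θ.εbg V))) :
    (leavesP w P).smallCouplings → (leavesP w P).smallFieldInductive :=
  thm3Member_stage13SepCoPH_atDomAlt_of_crit_of_rider_of_εreg_eq θ h hC P hε heq hord
    (hcrit_of_ukExists θ.toStage13Params.ν P.K hεreg hε3 hε2 hsolν) hb0 hcov hsolν hint hreg h11 hres huniq

/-- ★★★ **THE TWO-RADII DOOR OF RECORD WITH NO ORBIT BINDER AND NO SOLVABILITY BINDER**: at the record's two radii (`U_k` at `θ.εbg`, the cut-off's `U_{j+1}` at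
`θ.ν.εreg ≤ θ.εbg`) BOTH the one-orbit clause `horb` and the domain's solvability `hsolν` are dag-n09-w1 g2's THEOREMS from the door's own [B11] ×3 + the located
(8)-membership `hreg8` («the radius-`εbg` background of a small field is `εreg`-regular») + `0 ≤ εreg ≤ εbg` (`…N09HeredModFineOfThm1.orbitRel_Uk_UkSucc_iter_of_thm1_εbg_of_reg8`,
`…N09BackgroundRadiiTransfer.ukExists_εreg_of_h11_of_reg8`, BY NAME).  N09's located list at the small-field bookkeeping is then: (181)ˢᵒˡ `hcov`; the support clause at
the domains `hχdom`; (I19) `hint`; the analytic inclusion `hreg`; [B11] ×3 `h11 ∕ hres ∕ huniq`; `hreg8`, `0 ≤ εreg ≤ εbg`; `0 < ε₂₉` — NO set family, NO nesting, NO orbit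
clause, NO solvability clause, NO hereditary selection, NO axial convention.  CONDITIONAL; nothing of Bałaban asserted; N09 NOT discharged.
[cite: Balaban1987RG1, Thm 3 p.264, p.259, (1.1)–(1.3) p.260, (2.1)–(2.3) p.265, (2.9)–(2.10) pp.266–267; Balaban1985Variational, Thm 1 (8)–(10) p.279 and (181) p.307] -/
theorem thm3Member_stage13SepCoPH_atDomAlt_of_thm1_of_reg8 (θ : Stage13HParams F N) (h : θ.Provisos₁₃SepCoPH F N) {w : WorldP}
    (hC : w.C = (datumOfRecord₁₃SepCoPH F N θ h).C) (P : B12.RunParams) (hε : 0 < θ.ε₂₉)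
    (hreg8 : ∀ k, k ≤ P.K → ∀ V ∈ domAltOfRecord F N θ.ν P.K k, Uk F N P.K k θ.εbg V ∈ bgReg F N P.K k θ.toStage13Params.ν.εreg)
    (hle : θ.toStage13Params.ν.εreg ≤ θ.εbg) (hεreg : 0 ≤ θ.toStage13Params.ν.εreg)
    (hcov : ∀ j < P.K, ∀ (v : GaugeTransf (F.P P.K) (j + 1) (SU N)) (W : GaugeField (F.P P.K) (j + 1) (SU N)),
      UkExists F N P.K (j + 1) θ.toStage13Params.ν.εreg W →
        critCfgOfRecord F N θ.toStage13Params.ν P.K j (gaugeAct v W) = gaugeAct (liftTransf v) (critCfgOfRecord F N θ.toStage13Params.ν P.K j W))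
    (hχdom : ∀ j < P.K, ∀ U : GaugeField (F.P P.K) j (SU N), (avOfRecord F N P.K j).avg U ∈ domAltOfRecord F N θ.ν P.K (j + 1) →
      U ∉ domAltOfRecord F N θ.ν P.K j → chiβOfRecord₁₃ F N θ.toStage13Params P.K (gOfRecord₁₃ F N θ.toStage13Params P) j U = 0)
    (hint : ∀ j < P.K, Integrable (betaInputOfRecord F N (TβOfRecord₁₃ F N) (chiβOfRecord₁₃ F N θ.toStage13Params) P.K (gOfRecord₁₃ F N θ.toStage13Params P) j)
      (fieldMeasure (F.P P.K) j (SU N)))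
    (hreg : ∀ j < P.K, domAltOfRecord F N θ.ν P.K (j + 1) ⊆ regSetOfRecord F N P.K j
      (betaInputOfRecord F N (TβOfRecord₁₃ F N) (chiβOfRecord₁₃ F N θ.toStage13Params) P.K (gOfRecord₁₃ F N θ.toStage13Params P) j))
    (h11 : ∀ k, k ≤ P.K → ∀ V ∈ domAltOfRecord F N θ.ν P.K k, UkExists F N P.K k θ.εbg V ∧ UniqueUkOrbit F N P.K k θ.εbg V)
    (hres : ∀ k, k ≤ P.K → HRestrict F N θ.εbg P.K k (domAltOfRecord F N θ.ν P.K k))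
    (huniq : ∀ k, k ≤ P.K → ∀ V ∈ domAltOfRecord F N θ.ν P.K k, ∀ j < k,
      UniqueUkOrbit F N P.K (j + 1) θ.εbg (Averaging.iter (avOfRecord F N P.K) (j + 1) (Uk F N P.K k θ.εbg V))) :
    (leavesP w P).smallCouplings → (leavesP w P).smallFieldInductive :=
  thm3Member_stage13SepCoPH_atDomAlt_of_orbitRel θ h hC P hε hcov
    (ukExists_εreg_of_h11_of_reg8 θ.toStage13Params.ν θ.εbg P.K h11 hreg8 hle) hχdom hint hreg h11 hres huniq
    (orbitRel_Uk_UkSucc_iter_of_thm1_εbg_of_reg8 θ.toStage13Params.ν θ.εbg P.K hres huniq hreg8 hle hεreg)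

/-- **N09 AT `(w, P)`, TWO-RADII DOOR OF RECORD, own leaf + the inputs of `thm3Member_stage13SepCoPH_atDomAlt_of_thm1_of_reg8`** ⇒ `Dag.B12_main (leavesP w P)`.  CONDITIONAL;
N09 NOT discharged. [cite: Balaban1987RG1, Lemma 4 (3.53) p.280, Thm 3 p.264, p.259, (1.1)–(1.3) p.260, (2.1)–(2.3) p.265; Balaban1985Variational, Thm 1 (8)–(10) p.279 and (181) p.307] -/
theorem b12_main_stage13SepCoPH_of_leaf_atDomAlt_of_thm1_of_reg8 (θ : Stage13HParams F N) (h : θ.Provisos₁₃SepCoPH F N) {w : WorldP}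
    (hC : w.C = (datumOfRecord₁₃SepCoPH F N θ h).C) (P : B12.RunParams) (h12 : (leavesP w P).b12) (hε : 0 < θ.ε₂₉)
    (hreg8 : ∀ k, k ≤ P.K → ∀ V ∈ domAltOfRecord F N θ.ν P.K k, Uk F N P.K k θ.εbg V ∈ bgReg F N P.K k θ.toStage13Params.ν.εreg)
    (hle : θ.toStage13Params.ν.εreg ≤ θ.εbg) (hεreg : 0 ≤ θ.toStage13Params.ν.εreg)
    (hcov : ∀ j < P.K, ∀ (v : GaugeTransf (F.P P.K) (j + 1) (SU N)) (W : GaugeField (F.P P.K) (j + 1) (SU N)),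
      UkExists F N P.K (j + 1) θ.toStage13Params.ν.εreg W →
        critCfgOfRecord F N θ.toStage13Params.ν P.K j (gaugeAct v W) = gaugeAct (liftTransf v) (critCfgOfRecord F N θ.toStage13Params.ν P.K j W))
    (hχdom : ∀ j < P.K, ∀ U : GaugeField (F.P P.K) j (SU N), (avOfRecord F N P.K j).avg U ∈ domAltOfRecord F N θ.ν P.K (j + 1) →
      U ∉ domAltOfRecord F N θ.ν P.K j → chiβOfRecord₁₃ F N θ.toStage13Params P.K (gOfRecord₁₃ F N θ.toStage13Params P) j U = 0)
    (hint : ∀ j < P.K, Integrable (betaInputOfRecord F N (TβOfRecord₁₃ F N) (chiβOfRecord₁₃ F N θ.toStage13Params) P.K (gOfRecord₁₃ F N θ.toStage13Params P) j)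
      (fieldMeasure (F.P P.K) j (SU N)))
    (hreg : ∀ j < P.K, domAltOfRecord F N θ.ν P.K (j + 1) ⊆ regSetOfRecord F N P.K j
      (betaInputOfRecord F N (TβOfRecord₁₃ F N) (chiβOfRecord₁₃ F N θ.toStage13Params) P.K (gOfRecord₁₃ F N θ.toStage13Params P) j))
    (h11 : ∀ k, k ≤ P.K → ∀ V ∈ domAltOfRecord F N θ.ν P.K k, UkExists F N P.K k θ.εbg V ∧ UniqueUkOrbit F N P.K k θ.εbg V)
    (hres : ∀ k, k ≤ P.K → HRestrict F N θ.εbg P.K k (domAltOfRecord F N θ.ν P.K k))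
    (huniq : ∀ k, k ≤ P.K → ∀ V ∈ domAltOfRecord F N θ.ν P.K k, ∀ j < k,
      UniqueUkOrbit F N P.K (j + 1) θ.εbg (Averaging.iter (avOfRecord F N P.K) (j + 1) (Uk F N P.K k θ.εbg V))) :
    Dag.B12_main (leavesP w P) :=
  b12_main_of_leaf_of_thm3Member h12
    (thm3Member_stage13SepCoPH_atDomAlt_of_thm1_of_reg8 θ h hC P hε hreg8 hle hεreg hcov hχdom hint hreg h11 hres huniq)

/-! ## §4. The analytic binder in the type owner's vocabulary: `hreg` at the domains IS K0e's on-domain β-version proviso -/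

/-- **THE ANALYTIC INCLUSION IS THE ON-DOMAIN PROVISO OF RECORD**: with the small-field domains as bookkeeping sets, `hreg : domAlt_{j+1} ⊆ regSetOfRecord K j ρ_j` is
K0e's `domAlt_subset_regSetOfRecord` applied to def-T ∕ K0e's ON-DOMAIN β-VERSION PROVISO `HasContTransportOn K j ρ_j (domAlt_{j+1})` («the kernel transform of the (0.19)
density has a version continuous on the small-field domain» — [I] p. 259 «effective actions for small fields», Thm 1 p. 259; the run-indexed family is K0e's OFFERED
`HasContTransportAlongOnχ (TβOfRecord₁₃) (chiβOfRecord₁₃ θ) (fun K _ k => domAltOfRecord θ.ν K k)` at `(K, g) := (P.K, gOfRecord₁₃ θ P)`).  So the door reads, on the transport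
side, EXACTLY ONE proviso sentence per step — the one `P7-LOCATOR-AUDIT.md` locates as (F1)–(F3) — and nothing wider.  CONDITIONAL; nothing of Bałaban asserted; N09 NOT discharged.
[cite: Balaban1987RG1, Thm 1 p.259, (0.13) p.254, Thm 3 p.264, (1.1)–(1.3) p.260, (2.1)–(2.3) p.265, (2.9)–(2.10) pp.266–267; Balaban1985Variational, Thm 1 (8)–(10) p.279 and (181) p.307] -/
theorem thm3Member_stage13SepCoPH_atDomAlt_of_contTOn (θ : Stage13HParams F N) (h : θ.Provisos₁₃SepCoPH F N) {w : WorldP}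
    (hC : w.C = (datumOfRecord₁₃SepCoPH F N θ h).C) (P : B12.RunParams) (hε : 0 < θ.ε₂₉)
    (hcontT : ∀ j < P.K, HasContTransportOn F N P.K j
      (betaInputOfRecord F N (TβOfRecord₁₃ F N) (chiβOfRecord₁₃ F N θ.toStage13Params) P.K (gOfRecord₁₃ F N θ.toStage13Params P) j)
      (domAltOfRecord F N θ.ν P.K (j + 1)))
    (hcov : ∀ j < P.K, ∀ (v : GaugeTransf (F.P P.K) (j + 1) (SU N)) (W : GaugeField (F.P P.K) (j + 1) (SU N)),
      UkExists F N P.K (j + 1) θ.toStage13Params.ν.εreg W →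
        critCfgOfRecord F N θ.toStage13Params.ν P.K j (gaugeAct v W) = gaugeAct (liftTransf v) (critCfgOfRecord F N θ.toStage13Params.ν P.K j W))
    (hsolν : ∀ j < P.K, ∀ W ∈ domAltOfRecord F N θ.ν P.K (j + 1), UkExists F N P.K (j + 1) θ.toStage13Params.ν.εreg W)
    (hχdom : ∀ j < P.K, ∀ U : GaugeField (F.P P.K) j (SU N), (avOfRecord F N P.K j).avg U ∈ domAltOfRecord F N θ.ν P.K (j + 1) →
      U ∉ domAltOfRecord F N θ.ν P.K j → chiβOfRecord₁₃ F N θ.toStage13Params P.K (gOfRecord₁₃ F N θ.toStage13Params P) j U = 0)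
    (hint : ∀ j < P.K, Integrable (betaInputOfRecord F N (TβOfRecord₁₃ F N) (chiβOfRecord₁₃ F N θ.toStage13Params) P.K (gOfRecord₁₃ F N θ.toStage13Params P) j)
      (fieldMeasure (F.P P.K) j (SU N)))
    (h11 : ∀ k, k ≤ P.K → ∀ V ∈ domAltOfRecord F N θ.ν P.K k, UkExists F N P.K k θ.εbg V ∧ UniqueUkOrbit F N P.K k θ.εbg V)
    (hres : ∀ k, k ≤ P.K → HRestrict F N θ.εbg P.K k (domAltOfRecord F N θ.ν P.K k))
    (huniq : ∀ k, k ≤ P.K → ∀ V ∈ domAltOfRecord F N θ.ν P.K k, ∀ j < k,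
      UniqueUkOrbit F N P.K (j + 1) θ.εbg (Averaging.iter (avOfRecord F N P.K) (j + 1) (Uk F N P.K k θ.εbg V)))
    (horb : ∀ k, k ≤ P.K → ∀ V ∈ domAltOfRecord F N θ.ν P.K k, ∀ j < k, OrbitRel (j + 1) (Uk F N P.K k θ.εbg V)
      (Uk F N P.K (j + 1) θ.toStage13Params.ν.εreg (Averaging.iter (avOfRecord F N P.K) (j + 1) (Uk F N P.K k θ.εbg V)))) :
    (leavesP w P).smallCouplings → (leavesP w P).smallFieldInductive :=
  thm3Member_stage13SepCoPH_atDomAlt_of_orbitRel θ h hC P hε hcov hsolν hχdom hint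
    (fun j hj => domAlt_subset_regSetOfRecord θ.ν (hcontT j hj)) h11 hres huniq horb

end Summit.QuantumFields.YangMills.BalabanUVNodes.N09AtSmallFieldBookkeeping

end
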